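import Literature.NumberTheory.LFunctions.EntireFamilyZeroSum
import Literature.NumberTheory.LFunctions.EntireZeroSumWindow
import HarnessLib

/-!
# The zero terms of a finite family of entire functions against a WINDOW weight, from a log-free density bound
# and a zero-free region given as HYPOTHESES (Hoheisel's mechanism, abstract form)

Topic `Literature/NumberTheory/LFunctions`, namespace `Literature.NumberTheory.LFunctions.EntireEF`.  Everything here is
PROVED (theorems only; no named facts).

This is the family-agnostic form of the tree's `…ShortIntervalZeroSumZFR` (class group characters; Thorner–Zaman 2019
§§4.3, 5 with Hoheisel's short-interval weight): for a finite family `F_i` (`i ∈ ι`) of entire functions non-zero at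
some `c₀`, with a log-free density bound `Σ_i N_i(α, T) ≤ D e^{b(𝓠 + log(T+4))(1−α)}`, window counts
`Σ_{|γ−τ| ≤ 1/2} m_i ≤ W₀(A + log(|τ|+4))`, a predicate `E` (the exceptional segment) and a zero-free region of constant
`c_Z` for the zeros of height `≤ T₁` off `E`:
* `family_flatPart_window_le_zfr` — the flat finite part (Bombieri's partial summation against the density at height
  `T₁`): `Σ_i Σ_{|γ|≤T₁, ¬E, β≥1/4} m_i X^{β−1} ≤ 2eD exp(−c_Z log X/(2(𝓠 + log(T₁+4))))` when
  `e^{b(𝓠+log(T₁+4))} ≤ X^{1/2}`;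
* `family_zeroSum_window_le_zfr` — the whole zero sum against the Laplace transform of the window weight
  `g = windowTest lo hi ε` (`X = e^{hi+ε}`, `ℓ = hi − lo + 2ε`):
  `Σ_i Σ_{ρ ∈ u_i, ¬E} m_i(ρ)‖F(−ρ)‖ ≤ X(ℓ·2eD e^{−c_Z(hi+ε)/(2(𝓠+log(T₁+4)))} + ℓ X^{−3/4}|ι|(2T₁+3)W₀(A+log(T₁+5))`
  `+ (2M/ε)T₁^{−1/2}|ι|W₀(c₁A + c₂))`.
With `c_Z` supplied by the Deuring–Heilbronn phenomenon this is the input of Hoheisel–Linnik-type theorems in short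
intervals for any family (ideal classes: gen 19; ray classes / cosets of congruence class groups: the present use).

## References
* G. Hoheisel, *Primzahlprobleme in der Analysis*, S.-B. Preuss. Akad. Wiss. (1930) 580–588.
* J. Thorner, A. Zaman, ANT 13 (2019), §§4.3, 5 and Lemmas 4.5–4.6. [ThornerZaman2019]
* J. Lagarias, H. Montgomery, A. Odlyzko, Invent. Math. 54 (1979), §7. [LagariasMontgomeryOdlyzko1979]
-/

noncomputable section

open Complex Real MeasureTheory Set Filter Topology

namespace Literature.NumberTheory.LFunctions.EntireEF

open Literature.NumberTheory.LFunctions Literature.NumberTheory.LFunctions.NumberField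
  Literature.NumberTheory.LFunctions.TZWeight Literature.NumberTheory.LFunctions.WindowWeight
  Literature.NumberTheory.LFunctions.LinnikZeroSum

/-! ### The flat finite part -/

set_option maxHeartbeats 800000 in
/-- **The flat finite part of the zero sum of a finite family against a short-interval weight, zero-free region as a
parameter** (Bombieri's partial summation against the log-free density at height `T₁`): with the density bound
(`𝓠 ≥ 1`), `c_Z > 0` such that every zero of the family with `|γ| ≤ T₁`, `β ≥ 1/4`, off `E` has
`β ≤ 1 − c_Z/(𝓠 + log(|γ|+4))`, `X > 1`, `T₁ ≥ 1` and `e^{b(𝓠 + log(T₁+4))} ≤ X^{1/2}`: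
`Σ_i Σ_{|γ| ≤ T₁, ¬E, β ≥ 1/4} m_i X^{β−1} ≤ 2eD exp(−c_Z log X/(2(𝓠 + log(T₁+4))))`.
[cite: ThornerZaman2019, Lemmas 4.5–4.6, §5] -/
theorem family_flatPart_window_le_zfr {ι : Type*} [Fintype ι] {F : ι → ℂ → ℂ} (hF : ∀ i, Differentiable ℂ (F i))
    {c₀ : ℂ} (hc₀ : ∀ i, F i c₀ ≠ 0) {b D 𝓠 : ℝ} (hb : 0 < b) (hD : 0 < D) (h𝓠1 : 1 ≤ 𝓠)
    (hdens : ∀ (T : ℝ), 1 ≤ T → ∀ u : ι → Finset ℂ,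
        (∀ i, ∀ ρ ∈ u i, F i ρ = 0 ∧ 1 / 4 ≤ ρ.re ∧ ρ.re < 1 ∧ |ρ.im| ≤ T) →
        ∀ α : ℝ, α ≤ 1 →
          ∑ i, ∑ ρ ∈ u i with α ≤ ρ.re, (analyticOrderNatAt (F i) ρ : ℝ) ≤
            D * Real.exp (b * (𝓠 + Real.log (T + 4))) ^ (1 - α))
    (E : ℂ → Prop) [DecidablePred E] {c_Z : ℝ} (hcZ : 0 < c_Z) {X T₁ : ℝ} (hX : 1 < X) (hT₁ : 1 ≤ T₁)
    (hzfr : ∀ i (ρ : ℂ), F i ρ = 0 → 1 / 4 ≤ ρ.re → ρ.re < 1 → |ρ.im| ≤ T₁ → ¬ E ρ →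
      ρ.re ≤ 1 - c_Z / (𝓠 + Real.log (|ρ.im| + 4)))
    (hrange : Real.exp (b * (𝓠 + Real.log (T₁ + 4))) ≤ X ^ ((1 : ℝ) / 2)) :
    ∑ i, ∑ ρ ∈ (finite_nontrivialZeros_inter (hF i) (hc₀ i) T₁).toFinset with (¬ E ρ ∧ 1 / 4 ≤ ρ.re),
        (analyticOrderNatAt (F i) ρ : ℝ) * X ^ (ρ.re - 1) ≤
      2 * Real.exp 1 * D * Real.exp (-(c_Z * Real.log X / (2 * (𝓠 + Real.log (T₁ + 4))))) := by
  classical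
  have hX0 : 0 < X := by linarith
  have hlogT : 0 ≤ Real.log (T₁ + 4) := Real.log_nonneg (by linarith)
  set 𝓛 : ℝ := 𝓠 + Real.log (T₁ + 4) with h𝓛
  have h𝓛pos : 0 < 𝓛 := by rw [h𝓛]; linarith
  set B : ℝ := Real.exp (b * 𝓛) with hB
  have hB1 : 1 ≤ B := Real.one_le_exp (by positivity)
  have hsqrt_lt : X ^ ((1 : ℝ) / 2) < X := by
    conv_rhs => rw [← Real.rpow_one X]
    exact Real.rpow_lt_rpow_of_exponent_lt hX (by norm_num)
  have hBX : B < X := lt_of_le_of_lt hrange hsqrt_lt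
  set η : ℝ := c_Z / 𝓛 with hη
  have hη0 : 0 < η := div_pos hcZ h𝓛pos
  have hmemFin : ∀ i (ρ : ℂ), ρ ∈ (finite_nontrivialZeros_inter (hF i) (hc₀ i) T₁).toFinset ↔
      (F i ρ = 0 ∧ 0 < ρ.re ∧ ρ.re < 1) ∧ |ρ.im| ≤ T₁ := by
    intro i ρ; rw [Set.Finite.mem_toFinset]; rfl
  set Fin' : ι → Finset ℂ := fun i ↦
    ((finite_nontrivialZeros_inter (hF i) (hc₀ i) T₁).toFinset).filter (fun ρ ↦ ¬ E ρ ∧ 1 / 4 ≤ ρ.re) with hFin'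
  set s : Finset (Σ _ : ι, ℂ) := Finset.univ.sigma Fin' with hs
  have hmem : ∀ p ∈ s, (F p.1 p.2 = 0 ∧ 0 < p.2.re ∧ p.2.re < 1) ∧ |p.2.im| ≤ T₁ ∧ ¬ E p.2 ∧ 1 / 4 ≤ p.2.re := by
    rintro ⟨i, ρ⟩ hi
    rw [hs, Finset.mem_sigma] at hi
    obtain ⟨-, hρ⟩ := hi
    rw [hFin'] at hρ; dsimp only at hρ
    rw [Finset.mem_filter, hmemFin] at hρ
    exact ⟨hρ.1.1, hρ.1.2, hρ.2.1, hρ.2.2⟩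
  have hconv : ∑ i, ∑ ρ ∈ (finite_nontrivialZeros_inter (hF i) (hc₀ i) T₁).toFinset with (¬ E ρ ∧ 1 / 4 ≤ ρ.re),
      (analyticOrderNatAt (F i) ρ : ℝ) * X ^ (ρ.re - 1) =
      ∑ p ∈ s, (analyticOrderNatAt (F p.1) p.2 : ℝ) * X ^ (p.2.re - 1) := by
    rw [hs, Finset.sum_sigma]
  rw [hconv]
  -- the zero-free region off `E`, with `𝓛 ≥ 𝓠 + log(|γ|+4)`
  have hzfr' : ∀ p ∈ s, p.2.re ≤ 1 - η := by
    intro p hp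
    obtain ⟨⟨h0, hre0, hre1⟩, hγ, hexc, h14⟩ := hmem p hp
    have h1 := hzfr p.1 p.2 h0 h14 hre1 hγ hexc
    have hlog4 : 0 < Real.log (|p.2.im| + 4) := Real.log_pos (by linarith [abs_nonneg p.2.im])
    have hγ' : Real.log (|p.2.im| + 4) ≤ Real.log (T₁ + 4) :=
      Real.log_le_log (by linarith [abs_nonneg p.2.im]) (by linarith)
    have : η ≤ c_Z / (𝓠 + Real.log (|p.2.im| + 4)) := by
      rw [hη]
      exact div_le_div_of_nonneg_left hcZ.le (by linarith) (by rw [h𝓛]; linarith)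
    linarith
  -- the density bound at height `T₁`
  have hdens' : ∀ α : ℝ, α ≤ 1 - η →
      ∑ p ∈ s with α ≤ p.2.re, (analyticOrderNatAt (F p.1) p.2 : ℝ) ≤ D * B ^ (1 - α) := by
    intro α hα
    have hd' := hdens T₁ hT₁ Fin' (fun i ρ hρ ↦ ?_) α (by linarith)
    · refine le_of_eq_of_le ?_ (le_of_le_of_eq hd' (by rw [hB, h𝓛]))
      rw [hs]
      rw [show (∑ p ∈ (Finset.univ.sigma Fin') with α ≤ p.2.re, (analyticOrderNatAt (F p.1) p.2 : ℝ)) =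
          ∑ p ∈ Finset.univ.sigma (fun i ↦ (Fin' i).filter (fun ρ ↦ α ≤ ρ.re)),
            (analyticOrderNatAt (F p.1) p.2 : ℝ) by
        refine Finset.sum_congr ?_ fun _ _ ↦ rfl
        ext ⟨i, ρ⟩
        simp only [Finset.mem_filter, Finset.mem_sigma, Finset.mem_univ, true_and]]
      rw [Finset.sum_sigma]
    · rw [hFin'] at hρ; dsimp only at hρ
      rw [Finset.mem_filter, hmemFin] at hρ
      exact ⟨hρ.1.1.1, hρ.2.2, hρ.1.1.2.2, hρ.1.2⟩
  have hbomb := sum_mul_rpow_le_of_density s (fun p ↦ p.2.re) (fun p ↦ (analyticOrderNatAt (F p.1) p.2 : ℝ))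
    hB1 hBX hD.le (fun p _ ↦ Nat.cast_nonneg _) hzfr' hdens'
  -- `(B/X)^η ≤ exp(−η log X/2)` and `log X/log(X/B) ≤ 2`
  have hB0 : 0 < B := by linarith
  have hratio : Real.log X / Real.log (X / B) ≤ 2 := by
    have hlogB : Real.log B ≤ Real.log X / 2 := by
      have := Real.log_le_log hB0 hrange
      rw [hB, Real.log_rpow hX0] at this
      rw [hB]; linarith
    have hLX : 0 < Real.log X := Real.log_pos hX
    rw [Real.log_div hX0.ne' hB0.ne', div_le_iff₀ (by linarith)]
    linarith
  have hpow : (B / X) ^ η ≤ Real.exp (-(η * Real.log X / 2)) := by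
    have h1 : B / X ≤ X ^ (-(1 : ℝ) / 2) := by
      rw [div_le_iff₀ hX0, show X ^ (-(1:ℝ) / 2) * X = X ^ ((1 : ℝ) / 2) by
        rw [← Real.rpow_add_one hX0.ne']; norm_num]
      exact hrange
    calc (B / X) ^ η ≤ (X ^ (-(1 : ℝ) / 2)) ^ η := Real.rpow_le_rpow (by positivity) h1 hη0.le
      _ = Real.exp (-(η * Real.log X / 2)) := by
          rw [← Real.rpow_mul hX0.le, Real.rpow_def_of_pos hX0]; ring_nf
  have hgoal : Real.exp (-(c_Z * Real.log X / (2 * (𝓠 + Real.log (T₁ + 4))))) =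
      Real.exp (-(η * Real.log X / 2)) := by
    rw [hη, h𝓛]; congr 1; field_simp
  rw [hgoal]
  refine hbomb.trans ?_
  have h0 : 0 ≤ Real.exp 1 * D * (B / X) ^ η := by positivity
  calc Real.exp 1 * D * (B / X) ^ η * (Real.log X / Real.log (X / B))
      ≤ Real.exp 1 * D * (B / X) ^ η * 2 := mul_le_mul_of_nonneg_left hratio h0
    _ ≤ Real.exp 1 * D * Real.exp (-(η * Real.log X / 2)) * 2 :=
        mul_le_mul_of_nonneg_right (mul_le_mul_of_nonneg_left hpow (by positivity)) (by norm_num)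
    _ = _ := by ring

/-! ### The whole zero sum against the window weight -/

set_option maxHeartbeats 1600000 in
/-- **The zero terms of a finite family against a window weight, off the exceptional predicate, given a zero-free
region of constant `c_Z` up to height `T₁`** (Hoheisel's mechanism, abstract).  With the density bound (`𝓠 ≥ 1`),
window counts `Σ_{|γ−τ|≤1/2} m_i ≤ W₀(A + log(|τ|+4))`, the window `g = windowTest lo hi ε` (`0 < ε < lo < hi`),
`X = e^{hi+ε}`, `ℓ = hi − lo + 2ε`, a height `T₁ ≥ 1` with `e^{b(𝓠 + log(T₁+4))} ≤ X^{1/2}`, and finite sets `u_i`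
of non-trivial zeros of `F_i`:
`Σ_i Σ_{ρ ∈ u_i, ¬E} m_i(ρ)‖F(−ρ)‖ ≤ X·(ℓ·2eD e^{−c_Z(hi+ε)/(2(𝓠 + log(T₁+4)))}`
`+ ℓ X^{−3/4}|ι|(2T₁+3)W₀(A + log(T₁+5)) + (2M/ε)T₁^{−1/2}|ι|W₀(c₁A + c₂))`.
[cite: ThornerZaman2019, §4.3, §5] [cite: LagariasMontgomeryOdlyzko1979, §7] -/
theorem family_zeroSum_window_le_zfr {ι : Type*} [Fintype ι] {F : ι → ℂ → ℂ} (hF : ∀ i, Differentiable ℂ (F i))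
    {c₀ : ℂ} (hc₀ : ∀ i, F i c₀ ≠ 0) {b D 𝓠 : ℝ} (hb : 0 < b) (hD : 0 < D) (h𝓠1 : 1 ≤ 𝓠)
    (hdens : ∀ (T : ℝ), 1 ≤ T → ∀ u : ι → Finset ℂ,
        (∀ i, ∀ ρ ∈ u i, F i ρ = 0 ∧ 1 / 4 ≤ ρ.re ∧ ρ.re < 1 ∧ |ρ.im| ≤ T) →
        ∀ α : ℝ, α ≤ 1 →
          ∑ i, ∑ ρ ∈ u i with α ≤ ρ.re, (analyticOrderNatAt (F i) ρ : ℝ) ≤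
            D * Real.exp (b * (𝓠 + Real.log (T + 4))) ^ (1 - α))
    {W₀ A : ℝ} (hW₀0 : 0 ≤ W₀) (hAnn : 0 ≤ A)
    (hwin : ∀ i (τ : ℝ) (P : Finset ℂ), (∀ ρ ∈ P, F i ρ = 0 ∧ 0 < ρ.re ∧ ρ.re < 1 ∧ |ρ.im - τ| ≤ 1 / 2) →
      ∑ ρ ∈ P, (analyticOrderNatAt (F i) ρ : ℝ) ≤ W₀ * (A + Real.log (|τ| + 4)))
    (E : ℂ → Prop) [DecidablePred E] {c_Z : ℝ} (hcZ : 0 < c_Z)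
    {M : ℝ} (hM : ∀ y : ℝ, |iteratedDeriv 1 Real.smoothTransition y| ≤ M ∧ |iteratedDeriv 2 Real.smoothTransition y| ≤ M)
    {lo hi ε : ℝ} (hε : 0 < ε) (hεlo : ε < lo) (hlohi : lo < hi) {T₁ : ℝ} (hT₁ : 1 ≤ T₁)
    (hzfr : ∀ i (ρ : ℂ), F i ρ = 0 → 1 / 4 ≤ ρ.re → ρ.re < 1 → |ρ.im| ≤ T₁ → ¬ E ρ →
      ρ.re ≤ 1 - c_Z / (𝓠 + Real.log (|ρ.im| + 4)))
    (hrange : Real.exp (b * (𝓠 + Real.log (T₁ + 4))) ≤ Real.exp (hi + ε) ^ ((1 : ℝ) / 2))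
    (u : ι → Finset ℂ) (hu : ∀ i, ∀ ρ ∈ u i, F i ρ = 0 ∧ 0 < ρ.re ∧ ρ.re < 1) :
    ∑ i, ∑ ρ ∈ u i with ¬ E ρ,
        (analyticOrderNatAt (F i) ρ : ℝ) * ‖fordLaplace (windowTest lo hi ε) (-ρ)‖ ≤
      Real.exp (hi + ε) *
        ((hi - lo + 2 * ε) * (2 * Real.exp 1 * D *
            Real.exp (-(c_Z * (hi + ε) / (2 * (𝓠 + Real.log (T₁ + 4)))))) +
          (hi - lo + 2 * ε) * Real.exp (hi + ε) ^ (-(3 : ℝ) / 4) *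
            ((Fintype.card ι : ℝ) * ((2 * T₁ + 3) * (W₀ * (A + Real.log (T₁ + 5))))) +
          (2 * M / ε) * T₁ ^ (-((1 : ℝ) / 2)) *
            ((Fintype.card ι : ℝ) * (W₀ * (tailConst₁ * A + tailConst₂)))) := by
  classical
  obtain ⟨hc₁16, hc₂0⟩ := tailConst_nonneg
  set X : ℝ := Real.exp (hi + ε) with hX
  have hX0 : 0 < X := Real.exp_pos _
  have hX1 : 1 < X := by rw [hX]; exact Real.one_lt_exp_iff.2 (by linarith)
  set ℓ : ℝ := hi - lo + 2 * ε with hℓ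
  have hℓ0 : 0 ≤ ℓ := by rw [hℓ]; linarith
  have hM0 : 0 ≤ M := le_trans (abs_nonneg _) (hM 0).1
  have hmemFin : ∀ i (ρ : ℂ), ρ ∈ (finite_nontrivialZeros_inter (hF i) (hc₀ i) T₁).toFinset ↔
      (F i ρ = 0 ∧ 0 < ρ.re ∧ ρ.re < 1) ∧ |ρ.im| ≤ T₁ := by
    intro i ρ; rw [Set.Finite.mem_toFinset]; rfl
  -- (A) per member
  set S : ι → ℝ := fun i ↦
    ∑ ρ ∈ (finite_nontrivialZeros_inter (hF i) (hc₀ i) T₁).toFinset with (¬ E ρ ∧ 1 / 4 ≤ ρ.re),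
      (analyticOrderNatAt (F i) ρ : ℝ) * X ^ (ρ.re - 1) with hS
  set J : ℝ := ℓ * X ^ (-(3 : ℝ) / 4) * ((2 * T₁ + 3) * (W₀ * (A + Real.log (T₁ + 5)))) +
    (2 * M / ε) * T₁ ^ (-((1 : ℝ) / 2)) * (W₀ * (tailConst₁ * A + tailConst₂)) with hJ
  have hper : ∀ i, ∑ ρ ∈ u i with ¬ E ρ,
      (analyticOrderNatAt (F i) ρ : ℝ) * ‖fordLaplace (windowTest lo hi ε) (-ρ)‖ ≤ X * (ℓ * S i + J) := by
    intro i
    have hdp : DecidablePred (· ∈ nontrivialZeros (F i)) := fun _ ↦ Classical.propDecidable _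
    set Exc : Finset ℂ := ((finite_nontrivialZeros_inter (hF i) (hc₀ i) T₁).toFinset ∪ u i).filter E with hExc
    set u' : Finset (nontrivialZeros (F i)) :=
      ((u i).filter (fun ρ ↦ ¬ E ρ)).subtype (· ∈ nontrivialZeros (F i)) with hu'
    have key := sum_zeroTerm_window_le (hF i) (hc₀ i) (W := W₀) (A := A)
      hW₀0 hAnn (hwin i) hM hε hεlo hlohi hT₁ Exc u'
    -- the left side
    have h1 : u'.filter (fun ρ' : nontrivialZeros (F i) ↦ (ρ' : ℂ) ∉ Exc) = u' := by
      refine Finset.filter_true_of_mem fun ρ' hρ' ↦ ?_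
      rw [hu', Finset.mem_subtype, Finset.mem_filter] at hρ'
      rw [hExc, Finset.mem_filter, not_and_or]
      exact Or.inr hρ'.2
    rw [h1] at key
    have hLHS : ∑ ρ' ∈ u', (analyticOrderNatAt (F i) (ρ' : ℂ) : ℝ) *
        ‖fordLaplace (windowTest lo hi ε) (-(ρ' : ℂ))‖ =
        ∑ ρ ∈ u i with ¬ E ρ, (analyticOrderNatAt (F i) ρ : ℝ) * ‖fordLaplace (windowTest lo hi ε) (-ρ)‖ := by
      rw [hu']
      exact Finset.sum_subtype_of_mem
        (f := fun ρ : ℂ ↦ (analyticOrderNatAt (F i) ρ : ℝ) * ‖fordLaplace (windowTest lo hi ε) (-ρ)‖)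
        (fun ρ hρ ↦ hu i ρ (Finset.mem_filter.1 hρ).1)
    rw [hLHS] at key
    refine key.trans ?_
    refine mul_le_mul_of_nonneg_left ?_ hX0.le
    rw [add_assoc]
    refine add_le_add ?_ ?_
    · -- the flat part: the filter `ρ ∉ Exc` is `¬ E` on `Fin`
      refine mul_le_mul_of_nonneg_left (le_of_eq ?_) hℓ0
      rw [hS]; dsimp only
      refine Finset.sum_congr (Finset.filter_congr fun ρ hρ ↦ ?_) fun _ _ ↦ rfl
      rw [hExc, Finset.mem_filter, not_and_or]
      constructor
      · rintro ⟨h | h, h14⟩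
        · exact absurd (Finset.mem_union_left _ hρ) h
        · exact ⟨h, h14⟩
      · rintro ⟨h, h14⟩; exact ⟨Or.inr h, h14⟩
    · -- the junk of member `i`
      rw [hJ]
      refine add_le_add (mul_le_mul_of_nonneg_left ?_ ?_) le_rfl
      · change ∑ ρ ∈ (finite_nontrivialZeros_inter (hF i) (hc₀ i) T₁).toFinset,
          (analyticOrderNatAt (F i) ρ : ℝ) ≤ _
        refine sum_mult_le_of_window hW₀0 hAnn (hwin i) (by linarith) _ fun ρ hρ ↦ ?_
        rw [hmemFin] at hρ
        exact ⟨hρ.1.1, hρ.1.2.1, hρ.1.2.2, hρ.2⟩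
      · positivity
  -- (B) sum over the family
  have hsum : ∑ i, ∑ ρ ∈ u i with ¬ E ρ,
      (analyticOrderNatAt (F i) ρ : ℝ) * ‖fordLaplace (windowTest lo hi ε) (-ρ)‖ ≤
      X * (ℓ * ∑ i, S i + (Fintype.card ι : ℝ) * J) := by
    refine (Finset.sum_le_sum fun i _ ↦ hper i).trans (le_of_eq ?_)
    rw [← Finset.mul_sum, Finset.sum_add_distrib, Finset.mul_sum, Finset.sum_const, nsmul_eq_mul,
      Finset.card_univ]
  -- (C) the flat part by density + ZFR
  have hflat := family_flatPart_window_le_zfr hF hc₀ hb hD h𝓠1 hdens E hcZ hX1 hT₁ hzfr hrange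
  have hlogX : Real.log X = hi + ε := by rw [hX, Real.log_exp]
  rw [hlogX] at hflat
  -- (D) assemble
  refine hsum.trans ?_
  have hS0 : 0 ≤ ∑ i, S i := Finset.sum_nonneg fun i _ ↦ by
    rw [hS]; exact Finset.sum_nonneg fun ρ _ ↦ mul_nonneg (Nat.cast_nonneg _) (Real.rpow_nonneg hX0.le _)
  have hh0 : (0 : ℝ) ≤ (Fintype.card ι : ℝ) := Nat.cast_nonneg _
  have hflat' : ℓ * ∑ i, S i ≤ ℓ * (2 * Real.exp 1 * D *
      Real.exp (-(c_Z * (hi + ε) / (2 * (𝓠 + Real.log (T₁ + 4)))))) :=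
    mul_le_mul_of_nonneg_left hflat hℓ0
  refine mul_le_mul_of_nonneg_left ?_ hX0.le
  have e : (Fintype.card ι : ℝ) * J =
      ℓ * X ^ (-(3 : ℝ) / 4) * ((Fintype.card ι : ℝ) * ((2 * T₁ + 3) * (W₀ * (A + Real.log (T₁ + 5))))) +
        (2 * M / ε) * T₁ ^ (-((1 : ℝ) / 2)) * ((Fintype.card ι : ℝ) * (W₀ * (tailConst₁ * A + tailConst₂))) := by
    rw [hJ]; ring
  rw [hℓ] at hflat' e ⊢
  linarith [hflat', e]

end Literature.NumberTheory.LFunctions.EntireEF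

end
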